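import Summits.MatrixMultiplication.OmegaCensus.SmallFormats.MatMul22nRankGF2LowerBound
import Mathlib.LinearAlgebra.Matrix.NonsingularInverse
import HarnessLib

/-!
# ω-census family (a): output-flattening caps for X-restricted `⟨c,m,n⟩` (the 'flatten' entries of the cap tables)

Cell `pub-omega` (unit `pub-omega-tensor-g5`), topic `Summits/MatrixMultiplication/OmegaCensus` (sub-folder
`SmallFormats`). Framing (verbatim): lottery ticket; floor = certified bounds/negative ranges. HONEST FRAMING:
elementary bookkeeping (folklore flattening bound), written out so that EVERY restriction cap used by the census'
X-marginal / SAT instruments for `⟨2,2,n⟩` is a kernel statement: if `X₀ ∈ S` then every value `X₀ Y` of a bilinear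
computation of `X ↦ XY` on `S` lies in the span of its output vectors, so the length is at least
`dim {X₀ Y : Y}` — `m·n` for invertible `X₀` (`c = m`), `n` for `X₀ ≠ 0`. As caps (Wang Lemma 3 restriction, tree
`BilinComp.exists_restrict_of_forall_eq_zero`): in an `r`-term decomposition of `⟨2,2,n⟩` the X-forms annihilating an
invertible `X₀` number `≤ r − 2n`, those annihilating a nonzero `X₀` number `≤ r − n` (hence split planes `≤ r − 2n`).
Nothing here is progress on `ω`.
-/

namespace Summit.MatrixMultiplication.OmegaCensus.SmallFormats

open Module Matrix Literature.Computability.AlgebraicComplexity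

variable {k : Type*} [Field k]

/-- `Y ↦ X₀ Y` on rectangular matrices. -/
def mulLeftRect {c m n : ℕ} (X₀ : Matrix (Fin c) (Fin m) k) : Matrix (Fin m) (Fin n) k →ₗ[k] Matrix (Fin c) (Fin n) k where
  toFun Y := X₀ * Y
  map_add' := Matrix.mul_add X₀
  map_smul' a Y := Matrix.mul_smul X₀ a Y

/-- `mulLeftRect X₀ Y = X₀ Y`. -/
@[simp] theorem mulLeftRect_apply {c m n : ℕ} (X₀ : Matrix (Fin c) (Fin m) k) (Y : Matrix (Fin m) (Fin n) k) :
    mulLeftRect X₀ Y = X₀ * Y := rfl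

/-- All values `X₀ Y`, `X₀ ∈ S`, lie in the span of the output vectors of a computation of `X ↦ XY` on `S`. -/
theorem range_mulLeftRect_le_span {c m n : ℕ} {ι : Type*} [Fintype ι] (S : Submodule k (Matrix (Fin c) (Fin m) k))
    (β : BilinComp ((mulBilin k c m n).comp S.subtype) ι) {X₀ : Matrix (Fin c) (Fin m) k} (hX : X₀ ∈ S) :
    LinearMap.range (mulLeftRect (n := n) X₀) ≤ Submodule.span k (Set.range β.w) := by
  rintro _ ⟨Y, rfl⟩
  have h := β.map_eq_sum ⟨X₀, hX⟩ Y
  rw [LinearMap.comp_apply, Submodule.subtype_apply, mulBilin_apply] at h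
  rw [mulLeftRect_apply, h]
  exact Submodule.sum_mem _ fun i _ => Submodule.smul_mem _ _ (Submodule.subset_span ⟨i, rfl⟩)

/-- **Output flattening**: the length of a computation of `X ↦ XY` on `S ∋ X₀` is at least `dim {X₀ Y : Y}`. [folklore] -/
theorem finrank_range_mulLeftRect_le_card {c m n : ℕ} {ι : Type*} [Fintype ι]
    (S : Submodule k (Matrix (Fin c) (Fin m) k)) (β : BilinComp ((mulBilin k c m n).comp S.subtype) ι)
    {X₀ : Matrix (Fin c) (Fin m) k} (hX : X₀ ∈ S) :
    finrank k (LinearMap.range (mulLeftRect (n := n) X₀)) ≤ Fintype.card ι :=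
  (Submodule.finrank_mono (range_mulLeftRect_le_span S β hX)).trans (finrank_range_le_card β.w)

/-- `dim k^{m×n} = m·n`. -/
theorem finrank_matrix_fin (m n : ℕ) : finrank k (Matrix (Fin m) (Fin n) k) = m * n := by
  rw [Module.finrank_matrix]
  simp

/-- **Invertible element**: a computation of `X ↦ XY` on `S ∋ X₀` with `det X₀ ≠ 0` has at least `m·n` products
(`Y ↦ X₀ Y` is onto). [folklore] -/
theorem mul_le_card_of_mem_of_isUnit {m n : ℕ} {ι : Type*} [Fintype ι] (S : Submodule k (Matrix (Fin m) (Fin m) k))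
    (β : BilinComp ((mulBilin k m m n).comp S.subtype) ι) {X₀ : Matrix (Fin m) (Fin m) k} (hX : X₀ ∈ S)
    (hdet : IsUnit X₀.det) : m * n ≤ Fintype.card ι := by
  have hr : LinearMap.range (mulLeftRect (n := n) X₀) = ⊤ := by
    rw [LinearMap.range_eq_top]
    intro Y
    refine ⟨X₀⁻¹ * Y, ?_⟩
    rw [mulLeftRect_apply, ← Matrix.mul_assoc, Matrix.mul_nonsing_inv X₀ hdet, Matrix.one_mul]
  have h := finrank_range_mulLeftRect_le_card S β hX (n := n)
  rw [hr, finrank_top, finrank_matrix_fin] at h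
  exact h

/-- The matrix with row `j` equal to `v` and the other rows zero. -/
def rowAt {m n : ℕ} (j : Fin m) (v : Fin n → k) : Matrix (Fin m) (Fin n) k := fun a b => if a = j then v b else 0

/-- `(X₀ · rowAt j v) i b = X₀ i j · v b`. -/
theorem mul_rowAt_apply {c m n : ℕ} (X₀ : Matrix (Fin c) (Fin m) k) (j : Fin m) (v : Fin n → k) (i : Fin c) (b : Fin n) :
    (X₀ * rowAt j v) i b = X₀ i j * v b := by
  rw [Matrix.mul_apply, Finset.sum_eq_single j]
  · simp [rowAt]
  · intro a _ ha; simp [rowAt, ha]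
  · intro h; exact absurd (Finset.mem_univ j) h

/-- **Nonzero element**: a computation of `X ↦ XY` on `S ∋ X₀ ≠ 0` has at least `n` products. [folklore] -/
theorem le_card_of_mem_of_ne_zero {c m n : ℕ} {ι : Type*} [Fintype ι] (S : Submodule k (Matrix (Fin c) (Fin m) k))
    (β : BilinComp ((mulBilin k c m n).comp S.subtype) ι) {X₀ : Matrix (Fin c) (Fin m) k} (hX : X₀ ∈ S)
    (h0 : X₀ ≠ 0) : n ≤ Fintype.card ι := by
  -- a nonzero entry `X₀ i j`
  obtain ⟨i, j, hij⟩ : ∃ i j, X₀ i j ≠ 0 := by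
    by_contra hcon
    apply h0
    ext i j
    by_contra h'
    exact hcon ⟨i, j, h'⟩
  -- `v ↦ X₀ · rowAt j v` is injective into the range
  let L : (Fin n → k) →ₗ[k] Matrix (Fin c) (Fin n) k :=
    { toFun := fun v => X₀ * rowAt j v
      map_add' := fun v w => by
        ext a b; simp only [mul_rowAt_apply, Matrix.add_apply, Pi.add_apply, mul_add]
      map_smul' := fun s v => by
        ext a b; simp only [mul_rowAt_apply, Matrix.smul_apply, Pi.smul_apply, smul_eq_mul, RingHom.id_apply]; ring }
  have hinj : Function.Injective L := by
    intro v w hvw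
    funext b
    have h := congr_fun (congr_fun hvw i) b
    simp only [L, LinearMap.coe_mk, AddHom.coe_mk, mul_rowAt_apply] at h
    exact mul_left_cancel₀ hij h
  have hle : LinearMap.range L ≤ LinearMap.range (mulLeftRect (n := n) X₀) := by
    rintro _ ⟨v, rfl⟩
    exact ⟨rowAt j v, rfl⟩
  have h1 : finrank k (Fin n → k) ≤ finrank k (LinearMap.range (mulLeftRect (n := n) X₀)) := by
    calc finrank k (Fin n → k) = finrank k (LinearMap.range L) := (LinearMap.finrank_range_of_inj hinj).symm
      _ ≤ _ := Submodule.finrank_mono hle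
  have h2 := finrank_range_mulLeftRect_le_card S β hX (n := n)
  rw [Module.finrank_fin_fun] at h1
  omega

/-! ## As caps for `⟨2,2,n⟩` (terms annihilating `X₀`) -/

/-- **Line cap, invertible `X₀`**: in a computation of `⟨2,2,n⟩` with first forms `x ↦ dotX (A i) x`, the products with
`A i ⊥ X₀`, `det X₀ ≠ 0`, number at most `|ι| − 2n` (this also bounds every split plane `span(X₀, X₁) ∋ X₀`). -/
theorem two_mul_add_card_perp_le_of_isUnit {n : ℕ} {ι : Type*} [Fintype ι] [DecidableEq ι]
    (β : BilinComp (mulBilin k 2 2 n) ι) (A : ι → Fin 2 × Fin 2 → k) (hA : ∀ i x, β.f i x = dotX (A i) x)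
    (X₀ : Matrix (Fin 2) (Fin 2) k) (hdet : IsUnit X₀.det)
    (p : ι → Prop) [DecidablePred p] (hp : ∀ i, p i → dotX (A i) X₀ = 0) :
    2 * n + (Finset.univ.filter p).card ≤ Fintype.card ι := by
  classical
  set S : Submodule k (Matrix (Fin 2) (Fin 2) k) := Submodule.span k {X₀} with hSdef
  set J := Finset.univ.filter p with hJdef
  have hJ : ∀ i ∈ J, ∀ x ∈ S, β.f i x = 0 := by
    intro i hi x hx
    rw [hJdef, Finset.mem_filter] at hi
    have hle : S ≤ LinearMap.ker (β.f i) := by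
      rw [hSdef, Submodule.span_le]
      intro y hy
      rw [Set.mem_singleton_iff] at hy
      rw [SetLike.mem_coe, LinearMap.mem_ker, hA, hy]
      exact hp i hi.2
    exact hle hx
  obtain ⟨r, hr, ⟨β'⟩⟩ := β.exists_restrict_of_forall_eq_zero S J hJ
  have h := mul_le_card_of_mem_of_isUnit S β' (Submodule.subset_span rfl) hdet (n := n)
  rw [Fintype.card_fin] at h
  have hJle : J.card ≤ Fintype.card ι := Finset.card_le_univ J
  omega

/-- **Line cap, nonzero `X₀`**: the products with `A i ⊥ X₀`, `X₀ ≠ 0`, number at most `|ι| − n`. -/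
theorem add_card_perp_le_of_ne_zero {n : ℕ} {ι : Type*} [Fintype ι] [DecidableEq ι]
    (β : BilinComp (mulBilin k 2 2 n) ι) (A : ι → Fin 2 × Fin 2 → k) (hA : ∀ i x, β.f i x = dotX (A i) x)
    (X₀ : Matrix (Fin 2) (Fin 2) k) (h0 : X₀ ≠ 0)
    (p : ι → Prop) [DecidablePred p] (hp : ∀ i, p i → dotX (A i) X₀ = 0) :
    n + (Finset.univ.filter p).card ≤ Fintype.card ι := by
  classical
  set S : Submodule k (Matrix (Fin 2) (Fin 2) k) := Submodule.span k {X₀} with hSdef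
  set J := Finset.univ.filter p with hJdef
  have hJ : ∀ i ∈ J, ∀ x ∈ S, β.f i x = 0 := by
    intro i hi x hx
    rw [hJdef, Finset.mem_filter] at hi
    have hle : S ≤ LinearMap.ker (β.f i) := by
      rw [hSdef, Submodule.span_le]
      intro y hy
      rw [Set.mem_singleton_iff] at hy
      rw [SetLike.mem_coe, LinearMap.mem_ker, hA, hy]
      exact hp i hi.2
    exact hle hx
  obtain ⟨r, hr, ⟨β'⟩⟩ := β.exists_restrict_of_forall_eq_zero S J hJ
  have h := le_card_of_mem_of_ne_zero S β' (Submodule.subset_span rfl) h0 (n := n)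
  rw [Fintype.card_fin] at h
  have hJle : J.card ≤ Fintype.card ι := Finset.card_le_univ J
  omega

end Summit.MatrixMultiplication.OmegaCensus.SmallFormats
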